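import Mathlib
import HarnessLib.Audit
import Summits.PneNP.PneNP.Theorems.PstarNorUnitDirAssembly
import Summits.PneNP.PneNP.Theorems.PstarNorUnitCover

/-!
# All chords NOR-forced ⟹ `#J₀ ≤ 5`, unconditionally in the core (ROUND-24, memo §9 R9; the NOR branch of `regime_cases` closed)

FRONTIER range-avoidance ladder, rung F-N3, ROUND 24 (cell `pnp-ideate`, planner memo `r24/CORE-BOUND-NOTES.md` §9 R5–R9, §13 (P3); restricted-model
proof complexity — nothing here bears on `P` versus `NP`).

`PstarNorUnitDirAssembly.card_units_le_five_dir` bounds the unit family `N ∪ ⋃ₑ D e` by five; `PstarNorUnitCover.subset_units` shows that a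
leafless core whose unit family is leafless with at most five outputs IS its unit family (no bridges).  Together: for well-formed bridge data on a
pure typed `(r,3/2)`-expanding instance with simple overlaps, `J₀` XOR-closed with `#J₀ < r`, `#(J₀ ∪ G₁ ∪ G₂) ≤ r`, pendants off the core,
`J₀ ∖ N` peelable (the spanning forest of `PstarChordBridgeAssemble.exists_bridgeData`), `N ≠ ∅`, and every chord (NOR) with respect to `q_m`
— `#J₀ ≤ 5` (`card_le_five_of_all_nor`, and `card_le_five_of_regime_nor` in the verbatim shape of `PstarChordBridgeBasis.regime_cases`).
No covering hypothesis remains.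
-/

set_option linter.dupNamespace false -- `Summit.PneNP.PneNP.…`: summit = sub-problem name (D-0017 single-conjunct layout)

open Finset Literature.Computability.Complexity
open Summit.PneNP.PneNP.Theorems.PstarTyped (Typed)
open Summit.PneNP.PneNP.Theorems.PstarSALevel (BoundaryExpanding SimpleOverlap)
open Summit.PneNP.PneNP.Theorems.PstarCoreBound (XorClosed)
open Summit.PneNP.PneNP.Theorems.PstarCubeIdeals (IsAffineFn)
open Summit.PneNP.PneNP.Theorems.PstarProductRank (qform)
open Summit.PneNP.PneNP.Theorems.PstarChordBridge (BridgeData)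
open Summit.PneNP.PneNP.Theorems.PstarChordBridgeForcing (gam)
open Summit.PneNP.PneNP.Theorems.PstarChordBridgeCotree (Peelable)
open Summit.PneNP.PneNP.Theorems.PstarReadSumset (V2)
open Summit.PneNP.PneNP.Theorems.PstarChordBridgeBasis (qDir polarDir)
open Summit.PneNP.PneNP.Theorems.PstarNorUnitDirAssembly (xorClosed_units card_units_le_five_dir)
open Summit.PneNP.PneNP.Theorems.PstarNorUnitCoverTools (two_le_xpdeg_of_xorClosed)
open Summit.PneNP.PneNP.Theorems.PstarNorUnitCover (subset_units)

namespace Summit.PneNP.PneNP.Theorems.PstarNorUnitFinal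

variable {n m : ℕ}

/-- **All chords NOR-forced in direction `mv` ⟹ `#J₀ ≤ 5`.** -/
theorem card_le_five_of_all_nor (I : LocalMap 4 n m) (hI : I.IsPure xorAndPred) (hT : Typed I) (hS : SimpleOverlap I) {r : ℕ}
    (hB : BoundaryExpanding r I) {B : BridgeData n m} (hW : B.WF I) (hr : (B.J₀ ∪ B.G₁ ∪ B.G₂).card ≤ r) (hJr : B.J₀.card < r)
    (hX : XorClosed I B.J₀) (hP : Peelable I (B.J₀ \ B.N)) (hG₁ : Disjoint B.G₁ B.J₀) (hG₂ : Disjoint B.G₂ B.J₀) (hN : B.N.Nonempty)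
    (mv : V2)
    (hNOR : ∀ e ∈ B.N, ∃ a b : Fin n → ZMod 2, ∃ β α : ZMod 2, ∃ m₁ m₂ : (Fin n → ZMod 2) → ZMod 2,
      polarDir I B mv a b = 1 ∧
      (∀ x, qDir I B mv x = (polarDir I B mv x b + β) * (polarDir I B mv x a + α) + 1) ∧
      IsAffineFn m₁ ∧ IsAffineFn m₂ ∧
      ∀ x, qform (B.D e) (fun j => I.vars j 2) (fun j => I.vars j 3) x + (gam B e + 1) =
        (polarDir I B mv x b + β + 1) * m₁ x + (polarDir I B mv x a + α + 1) * m₂ x) :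
    B.J₀.card ≤ 5 := by
  classical
  have h5 := card_units_le_five_dir I hI hS hB hW hr hJr hG₁ hG₂ hN mv hNOR
  exact le_trans (card_le_card (subset_units I hI hS hW.hN hP hW.hD hW.hDeven (two_le_xpdeg_of_xorClosed I hT hX)
    (two_le_xpdeg_of_xorClosed I hT (xorClosed_units I hI hW)) h5)) h5

/-- The same with the NOR data in the exact shape of the third disjunct of `PstarChordBridgeBasis.regime_cases`. -/
theorem card_le_five_of_regime_nor (I : LocalMap 4 n m) (hI : I.IsPure xorAndPred) (hT : Typed I) (hS : SimpleOverlap I) {r : ℕ}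
    (hB : BoundaryExpanding r I) {B : BridgeData n m} (hW : B.WF I) (hr : (B.J₀ ∪ B.G₁ ∪ B.G₂).card ≤ r) (hJr : B.J₀.card < r)
    (hX : XorClosed I B.J₀) (hP : Peelable I (B.J₀ \ B.N)) (hG₁ : Disjoint B.G₁ B.J₀) (hG₂ : Disjoint B.G₂ B.J₀) (hN : B.N.Nonempty)
    (mv : V2)
    (hNOR : ∀ e ∈ B.N, ∃ a b : Fin n → ZMod 2, polarDir I B mv a b = 1 ∧
      (∀ x, qDir I B mv x =
        (polarDir I B mv x b + (qDir I B mv b + qDir I B mv 0)) * (polarDir I B mv x a + (qDir I B mv a + qDir I B mv 0)) + 1) ∧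
      ∃ m₁ m₂ : (Fin n → ZMod 2) → ZMod 2, IsAffineFn m₁ ∧ IsAffineFn m₂ ∧
        ∀ x, qform (B.D e) (fun j => I.vars j 2) (fun j => I.vars j 3) x + (gam B e + 1) =
          (polarDir I B mv x b + (qDir I B mv b + qDir I B mv 0) + 1) * m₁ x +
          (polarDir I B mv x a + (qDir I B mv a + qDir I B mv 0) + 1) * m₂ x) :
    B.J₀.card ≤ 5 :=
  card_le_five_of_all_nor I hI hT hS hB hW hr hJr hX hP hG₁ hG₂ hN mv fun e he => by
    obtain ⟨a, b, hab, hq, m₁, m₂, hm₁, hm₂, hQ⟩ := hNOR e he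
    exact ⟨a, b, _, _, m₁, m₂, hab, hq, hm₁, hm₂, hQ⟩

end Summit.PneNP.PneNP.Theorems.PstarNorUnitFinal
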